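import Summits.QuantumFields.YangMills.Theorems.LuscherReductionTwistedTraceScalingBOTransportEnvelope
import Summits.QuantumFields.YangMills.Theorems.LuscherReductionTwistedTraceScalingBOStiffColour
import HarnessLib

/-!
# (B-ST) step (S2), core part: the CORE-RESTRICTED BASED-AVERAGED KERNEL is two-sided near the product `k(u',u)·G₁(v',v)` — pointwise, for every pair of tube points in the cores
# (lane A of S-BASE, crux `TwistedTraceScaling` stmt-QuantumFields-20203, C4-CORE, the (B-ST) pen; HANDOFF-g21 (S2))

Step (A) (`…BOStiffColour.tubeForm_le_qform_basedIntegral`) bounds the tube form by the form of the BASED-averaged kernel `G(U,V) = ∫ K_β(U, V^{basedExt h}) dh`, and the slow ⊗ fibre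
assembly (`…BOStiffSlowAssembly.form_le_of_product_near`) needs `|G − k⊗M| ≤ η_t·k⊗M + τ` on the cores.  The exact transport `…BOTransport.transferKernel_orthoTube_transport` and the
pointwise envelope `…BOTransportEnvelope.abs_transportExponent_le` give the relative part for the CORE-restricted based average
`G_T(U,V) = ∫ 𝟙{∀x, ‖h_x − 1‖ ≤ T}·K_β(U, V^{basedExt h}) dh`:
★★★ `basedKernel_core_two_sided` — for output/input slow data `u', u` in the window (`‖u'_k − 1‖ ≤ δ ≤ 1/2`, `‖u'_k − u_k‖ ≤ α ≤ 1`, one-site actions `≤ σ/L³`, `σ < 2`) and fibre data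
`v', v` in the core (`|v_{e,c}| ≤ T ≤ 1/30`, `‖v̂‖ ≤ R`):
`e^{−η}·ρ·G_T(oT 1 v', oT 1 v) ≤ G_T(oT u' v', oT u v) ≤ e^{η}·ρ·G_T(oT 1 v', oT 1 v)`, `ρ = K₁^{(L³β)}(u',u)/K₁(1,1)`, `η = coreEta L β δ α T R (|Site|·T) σ + coreEps1 L β δ T R + coreEps2 L β δ T R σ`
(so `|G_T − ρ·G_T^{central}| ≤ (e^{η} − 1)·ρ·G_T^{central}`: the `η_t` of the assembly; on schedule B `η = O(β^{-s}ℓ⁴ + β^{-1/2}ℓ⁸) → 0`).  The complement `G − G_T` (based fields with a large jump)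
is an absolute tail (`…BTTailKernel.kinDefect_ge_off_core`, next file).
HONEST FRAMING: elementary inequalities for a stub of a child of the CONDITIONAL route R2b1; (B-ST) OPEN; C4-CORE OPEN; not infinite volume, not a gap, not Clay.
-/

set_option autoImplicit false

noncomputable section

open MeasureTheory Filter Topology Real
open scoped BigOperators
open Literature.MathematicalPhysics.QuantumFieldTheory
open Literature.MathematicalPhysics.QuantumLattice

namespace Summit.QuantumFields.YangMills.Theorems.FemtoTransferGap.TwoLattice.ConstTube

open Summit.QuantumFields.YangMills.Theorems.FemtoTransferGap
open Summit.QuantumFields.YangMills.Theorems.FemtoTransferGap.TwoLattice.Avg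
open Summit.QuantumFields.YangMills.Theorems.FemtoTransferGap.TwoLattice.Stiff (LinkSpace)

variable {L : ℕ} [NeZero L]

/-- A based extension of a `T`-core field is in the gauge core: every value is `T`-close to `1` and the colour-vector sum is at most `|Site|·T`. [folklore] -/
theorem basedExt_core {T : ℝ} (hT0 : 0 ≤ T) {h : NzSite L → SU2} (hh : ∀ y, ‖su2Quat (h y) - 1‖ ≤ T) :
    (∀ x, ‖su2Quat (basedExt L h x) - 1‖ ≤ T) ∧ ‖∑ x, vecPart (basedExt L h x)‖ ≤ Fintype.card (Site 3 L) * T := by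
  have h1 : ∀ x, ‖su2Quat (basedExt L h x) - 1‖ ≤ T := fun x => by
    by_cases hx : x = 0
    · subst hx
      have h1 := @Literature.MathematicalPhysics.QuantumFieldTheory.Balaban1983to89.T4HaarSU2Translate.su2Quat_one
      simp only [basedExt_zero, h1, sub_self, norm_zero]; exact hT0
    · rw [basedExt_of_ne L h hx]; exact hh ⟨x, hx⟩
  refine ⟨h1, (norm_sum_le _ _).trans ?_⟩
  calc ∑ x, ‖vecPart (basedExt L h x)‖ ≤ ∑ _x : Site 3 L, T := Finset.sum_le_sum fun x _ => (norm_vecPart_le_norm_sub_one _).trans (h1 x)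
    _ = Fintype.card (Site 3 L) * T := by simp [Finset.sum_const, Finset.card_univ]

/-- ★★★ **THE CORE-RESTRICTED BASED-AVERAGED KERNEL IS TWO-SIDED NEAR THE PRODUCT** (see the module docstring). [cite: Luscher1983, §3] -/
theorem basedKernel_core_two_sided {β : ℝ} (hβ : 0 ≤ β) (u' u : GaugeConfig 3 1 SU2) {v' v : Edge 3 L → Fin 3 → ℝ} (hv' : v' ∈ capBalancedSet L) (hv : v ∈ capBalancedSet L)
    {δ α T R σ : ℝ} (hδ : ∀ k : Fin 3, ‖su2Quat (u' (0, k)) - 1‖ ≤ δ) (hδ1 : δ ≤ 1 / 2) (hα : ∀ k : Fin 3, ‖su2Quat (u' (0, k)) - su2Quat (u (0, k))‖ ≤ α) (hα1 : α ≤ 1)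
    (hT0 : 0 ≤ T) (hT : T ≤ 1 / 30) (hσ : σ < 2) (hS' : (L : ℝ) ^ 3 * wilsonAction su2Rep u' ≤ σ) (hS : (L : ℝ) ^ 3 * wilsonAction su2Rep u ≤ σ)
    (hv'T : ∀ (e : Edge 3 L) (c : Fin 3), |v' e c| ≤ T) (hx' : ‖linkEmbed L v'‖ ≤ R) (hvT : ∀ (e : Edge 3 L) (c : Fin 3), |v e c| ≤ T) (hx : ‖linkEmbed L v‖ ≤ R) :
    Real.exp (-(coreEta L β δ α T R (Fintype.card (Site 3 L) * T) σ + coreEps1 L β δ T R + coreEps2 L β δ T R σ)) *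
        (transferKernel su2Rep ((L : ℝ) ^ 3 * β) u' u / transferKernel su2Rep ((L : ℝ) ^ 3 * β) (1 : GaugeConfig 3 1 SU2) 1) *
        (∫ h, {h : NzSite L → SU2 | ∀ y, ‖su2Quat (h y) - 1‖ ≤ T}.indicator (fun _ => (1 : ℝ)) h *
          transferKernel su2Rep β (orthoTube L 1 v') (gaugeTransform (basedExt L h) (orthoTube L 1 v)) ∂basedMeasure L) ≤
      ∫ h, {h : NzSite L → SU2 | ∀ y, ‖su2Quat (h y) - 1‖ ≤ T}.indicator (fun _ => (1 : ℝ)) h *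
          transferKernel su2Rep β (orthoTube L u' v') (gaugeTransform (basedExt L h) (orthoTube L u v)) ∂basedMeasure L ∧
    ∫ h, {h : NzSite L → SU2 | ∀ y, ‖su2Quat (h y) - 1‖ ≤ T}.indicator (fun _ => (1 : ℝ)) h *
          transferKernel su2Rep β (orthoTube L u' v') (gaugeTransform (basedExt L h) (orthoTube L u v)) ∂basedMeasure L ≤
      Real.exp (coreEta L β δ α T R (Fintype.card (Site 3 L) * T) σ + coreEps1 L β δ T R + coreEps2 L β δ T R σ) *
        (transferKernel su2Rep ((L : ℝ) ^ 3 * β) u' u / transferKernel su2Rep ((L : ℝ) ^ 3 * β) (1 : GaugeConfig 3 1 SU2) 1) *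
        (∫ h, {h : NzSite L → SU2 | ∀ y, ‖su2Quat (h y) - 1‖ ≤ T}.indicator (fun _ => (1 : ℝ)) h *
          transferKernel su2Rep β (orthoTube L 1 v') (gaugeTransform (basedExt L h) (orthoTube L 1 v)) ∂basedMeasure L) := by
  haveI : SecondCountableTopology SU2 := secondCountableTopology_su2
  haveI : IsProbabilityMeasure (basedMeasure L) := by unfold basedMeasure; infer_instance
  set η : ℝ := coreEta L β δ α T R (Fintype.card (Site 3 L) * T) σ + coreEps1 L β δ T R + coreEps2 L β δ T R σ with hη
  set ρ : ℝ := transferKernel su2Rep ((L : ℝ) ^ 3 * β) u' u / transferKernel su2Rep ((L : ℝ) ^ 3 * β) (1 : GaugeConfig 3 1 SU2) 1 with hρ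
  set C : Set (NzSite L → SU2) := {h | ∀ y, ‖su2Quat (h y) - 1‖ ≤ T} with hC
  have hρ0 : 0 < ρ := div_pos (transferKernel_pos _ _ _ _) (transferKernel_pos _ _ _ _)
  -- the two integrands, pointwise transport on the core
  set I : (NzSite L → SU2) → ℝ := fun h => C.indicator (fun _ => (1 : ℝ)) h * transferKernel su2Rep β (orthoTube L u' v') (gaugeTransform (basedExt L h) (orthoTube L u v))
  set J : (NzSite L → SU2) → ℝ := fun h => C.indicator (fun _ => (1 : ℝ)) h * transferKernel su2Rep β (orthoTube L 1 v') (gaugeTransform (basedExt L h) (orthoTube L 1 v))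
  have hpt : ∀ h, Real.exp (-η) * ρ * J h ≤ I h ∧ I h ≤ Real.exp η * ρ * J h := fun h => by
    by_cases hh : h ∈ C
    · simp only [I, J, Set.indicator_of_mem hh, one_mul]
      have ht := transferKernel_orthoTube_transport (L := L) β u' u v' v (basedExt L h)
      obtain ⟨hgT, hΓ⟩ := basedExt_core (L := L) hT0 hh
      have hX := abs_transportExponent_le (L := L) hβ u' u hv' hv hδ hδ1 hα hα1 hT hσ hS' hS hv'T hx' hvT hx hgT hΓ
      rw [abs_le] at hX
      have hK1 : 0 < transferKernel su2Rep β (orthoTube L 1 v') (gaugeTransform (basedExt L h) (orthoTube L 1 v)) := transferKernel_pos _ _ _ _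
      rw [ht]
      constructor
      · have := Real.exp_le_exp.2 hX.1
        nlinarith [mul_pos hρ0 hK1, this, Real.exp_pos (-η)]
      · have := Real.exp_le_exp.2 hX.2
        nlinarith [mul_pos hρ0 hK1, this, Real.exp_pos (offX L β u' u v' v (basedExt L h) + diagX L β u' v' v (basedExt L h))]
    · simp only [I, J, Set.indicator_of_notMem hh, zero_mul, mul_zero]; exact ⟨le_rfl, le_rfl⟩
  -- measurability / integrability of the integrands
  have hCm : MeasurableSet C := by
    have hq := @Literature.MathematicalPhysics.QuantumFieldTheory.Balaban1983to89.T4HaarSU2Translate.continuous_su2Quat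
    have e : C = ⋂ y : NzSite L, {h : NzSite L → SU2 | ‖su2Quat (h y) - 1‖ ≤ T} := by ext h; simp [hC]
    rw [e]
    exact MeasurableSet.iInter fun y => measurableSet_le (((hq.comp (continuous_apply y)).sub continuous_const).norm).measurable measurable_const
  obtain ⟨M, hM⟩ := exists_transferKernel_le su2Rep continuous_su2Rep β (L := L)
  have hKm : ∀ (U V : GaugeConfig 3 L SU2), Measurable fun h : NzSite L → SU2 => transferKernel su2Rep β U (gaugeTransform (basedExt L h) V) := fun U V =>
    (measurable_transferKernel_gaugeTransform_right β U V).comp (measurable_basedExt L)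
  have hint : ∀ (U V : GaugeConfig 3 L SU2), Integrable (fun h : NzSite L → SU2 => C.indicator (fun _ => (1 : ℝ)) h * transferKernel su2Rep β U (gaugeTransform (basedExt L h) V))
      (basedMeasure L) := fun U V =>
    integrable_of_measurable_abs_le _ ((measurable_const.indicator hCm).mul (hKm U V)) (C := M) fun h => by
      by_cases hh : h ∈ C
      · rw [Set.indicator_of_mem hh, one_mul, abs_of_pos (transferKernel_pos _ _ _ _)]; exact hM _ _
      · rw [Set.indicator_of_notMem hh, zero_mul, abs_zero]; exact (transferKernel_pos su2Rep β U U).le.trans (hM U U)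
  have hI := hint (orthoTube L u' v') (orthoTube L u v)
  have hJ := hint (orthoTube L 1 v') (orthoTube L 1 v)
  constructor
  · have h := integral_mono (hJ.const_mul (Real.exp (-η) * ρ)) hI fun h => (hpt h).1
    rwa [integral_const_mul] at h
  · have h := integral_mono hI (hJ.const_mul (Real.exp η * ρ)) fun h => (hpt h).2
    rwa [integral_const_mul] at h

end Summit.QuantumFields.YangMills.Theorems.FemtoTransferGap.TwoLattice.ConstTube

end
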